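import Literature.Computability.QuantumComplexity.CWrapAssembly
import HarnessLib

/-!
# Promise problems from quantum search with classical pre- and post-processing

Topic `Literature/Computability/QuantumComplexity`; the last, generic step in the discharge of
`ajl_jonesApproxProblem_mem_PromiseBQP`. If a search relation `R` is solvable in bounded-error
quantum polynomial time, `h, g ∈ FP`, and on every good sample `y ∈ R (h x)` the post-processor's
output `g ⟨x, y⟩` starts with `1` for yes-instances and with `0` for no-instances, then the promise
problem is in `PromiseBQP` (`mem_PromiseBQP_of_isQSolvable`): the classical wrap
(`isQSolvable_classicalWrap_holds`) yields a uniform family whose output starts with `g ⟨x, y⟩`,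
`y ∈ R (h x)`, with probability `≥ 2/3`, and its first wire is the acceptance wire.

## References

* E. Bernstein, U. Vazirani, *Quantum complexity theory*, SIAM J. Comput. 26 (1997), §8
  [BernsteinVazirani1997].
* J. Watrous, *Quantum computational complexity*, in: Encyclopedia of Complexity and Systems
  Science, Springer 2009, §III.2 [Watrous2009].
-/

noncomputable section

namespace Literature.Computability.QuantumComplexity

open Cryptography Complexity

/-- Output-event probabilities of a family are monotone in the event. [folklore] -/
theorem kernelProb_mono (F : QCircuitFamily cliffordT) (A : Language Bool) (x : List Bool) {E E' : Set (List Bool)} (h : E ⊆ E') :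
    F.kernelProb A x E ≤ F.kernelProb A x E' := by
  unfold QCircuitFamily.kernelProb
  refine ENNReal.toReal_mono (ne_top_of_le_ne_top ENNReal.one_ne_top ?_) ((F.kernel A x).toOuterMeasure.mono h)
  rw [← ((F.kernel A x).toOuterMeasure_apply_eq_one_iff Set.univ).2 (Set.subset_univ _)]
  exact (F.kernel A x).toOuterMeasure.mono (Set.subset_univ _)

/-- **Promise problems from wrapped quantum search.** [cite: BernsteinVazirani1997, §8] [cite: Watrous2009, §III.2] -/
theorem mem_PromiseBQP_of_isQSolvable (Q : PromiseProblem) (h g : List Bool → List Bool) (hh : h ∈ FP) (hg : g ∈ FP)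
    {R : List Bool → Set (List Bool)} (hR : IsQSolvable R)
    (hyes : ∀ x ∈ Q.yes, ∀ y ∈ R (h x), [true] <+: g (boolPair x y))
    (hno : ∀ x ∈ Q.no, ∀ y ∈ R (h x), [false] <+: g (boolPair x y)) : Q ∈ PromiseBQP := by
  obtain ⟨F, hF, hU, hK⟩ := isQSolvable_classicalWrap_holds h g hh hg hR
  refine ⟨F, hF, hU, fun x hx => ?_, fun x hx => ?_⟩
  · -- yes: the wrapped event is inside "wire 0 reads 1"
    have hsub : {z | ∃ y ∈ R (h x), g (boolPair x y) <+: z} ⊆ {z | [true] <+: z} := by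
      rintro z ⟨y, hy, hz⟩; exact (hyes x hx y hy).trans hz
    have h1 := (hK x).trans (kernelProb_mono F 0 x hsub)
    rw [QCircuitFamily.kernelProb, QCircuitFamily.kernel,
      toReal_outputPMF_map_singleton_prefix QCircuit.outputPMF_apply_holds cliffordT_isUnitary_holds] at h1
    rw [QCircuitFamily.acceptProbOn, acceptProb_eq_wireZeroMass]
    exact h1
  · -- no: the wrapped event is inside "wire 0 reads 0", whose mass is `1 −` the acceptance
    have hsub : {z | ∃ y ∈ R (h x), g (boolPair x y) <+: z} ⊆ {z | [false] <+: z} := by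
      rintro z ⟨y, hy, hz⟩; exact (hno x hx y hy).trans hz
    have h1 := (hK x).trans (kernelProb_mono F 0 x hsub)
    rw [QCircuitFamily.kernelProb, QCircuitFamily.kernel,
      toReal_outputPMF_map_singleton_prefix QCircuit.outputPMF_apply_holds cliffordT_isUnitary_holds] at h1
    rw [QCircuitFamily.acceptProbOn, acceptProb_eq_wireZeroMass]
    have hpos : 0 < x.length + F.ancillas x.length := by
      by_contra h0
      unfold wireZeroMass at h1
      rw [Finset.sum_eq_zero (fun y _ => if_neg (by rintro ⟨h', _⟩; exact h0 h'))] at h1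
      norm_num at h1
    have := wireZeroMass_true_add_false QCircuit.outputPMF_apply_holds cliffordT_isUnitary_holds (F.circ x.length) x.get hpos
    linarith

end Literature.Computability.QuantumComplexity

end
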